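import Literature.Analysis.FluidPDE.PineauVicolEnstrophyTime
import Literature.Analysis.FluidPDE.PineauVicolLerayBounds
import Literature.Analysis.FluidPDE.KNSSThm52Integrand
import HarnessLib

/-!
# Crux `Target` (stmt-NavierStokesRegularity-1217), line `killing-twisted-bernoulli-solitons`:
  slice tools for STUB B4, the weighted gap lemma (`stub_weightedGapLemma`)

Support file (helpers only) for the weighted gap lemma of the rotated self-similar (RSS)
Liouville programme (Pineau–Vicol, arXiv:2607.09619, Proposition 3.1 and §7.5). The gap lemma is
run on ONE slice `s = 0` of the rotation-free Leray profile `V(s, y) = R(αs) U(R(−αs) y)` of an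
RSS field (`PineauVicol2026.lerayOrbit_pvAnsatz`), where `V(0) = U`. This file supplies:

* `weightedGap_integrable_of_le_inv_max_pow`: a measurable function dominated by
  `C · max{|y|, 1}^{−n}`, `n ≥ 4`, is integrable on `ℝ³`;
* `weightedGap_slice_integrable`: the four slice-integrability hypotheses of
  `PineauVicol2026.enstrophy_slice` (`|Ω|²`, `(1+|y|)|Ω|‖DΩ‖`, `‖DΩ‖²`, `|ΔΩ||Ω|`, `Ω = curl U`)
  from the Type-I derivative bounds `‖DᵏU(y)‖ ≤ K_k max{|y|,1}^{−(k+1)}`, `k = 1, 2, 3`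
  (`PineauVicol2026.exists_forall_iteratedFDeriv_lerayOrbit_le`);
* `weightedGap_integral_inner_fderiv_rotGen_self`: `∫ ⟪(Jy·∇)Ω, Ω⟫ = 0` for the rotation wind
  `J = rotGen` (`div J = tr J = 0`, `⟪(Jy·∇)Ω, Ω⟫ = div(½|Ω|² Jy)`, and `∫ div = 0` under the
  logarithmic flux condition of `PineauVicol2026.integral_divergence_eq_zero_of_integrable_div`);
* `weightedGap_inner_timeDeriv_vorticity_eq`, `weightedGap_timeTerm_eq_zero`: for a classical
  solution `V` of the backward Leray system which is a rigidly rotating profile,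
  `V(s) = R(αs) U R(−αs)`, the time term of the enstrophy identity at `s = 0` is
  `∫ ⟪∂ₛΩ(0), Ω(0)⟫ = −α ∫ ⟪DΩ_U(y)[Jy], Ω_U(y)⟫ = 0` (the vorticity is `R(αs) Ω_U(R(−αs)·)` by
  the equivariance of the curl, `PineauVicol2026.curl_rotZ_conj`; differentiate `½|Ω(s,y)|²` in
  `s` at `0` along the rotation orbit, `hasDerivAt_rotZ_zero`); `weightedGap_rssTimeTermVanishes`
  is its registered explicit-binder form.

Lands `--supports stmt-NavierStokesRegularity-1217` (registered helper stub
`weightedGap_rssTimeTermVanishes`).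
-/

noncomputable section

namespace Summit.NavierStokesRegularity.NavierStokesRegularity.Theorems

open MeasureTheory Set Function Filter Topology InnerProductSpace
open scoped RealInnerProductSpace ContDiff Laplacian ENNReal
open Literature.Analysis Literature.Analysis.FluidPDE Literature.Analysis.FluidPDE.PineauVicol2026

/-! ### Integrability from `max{|y|, 1}^{-n}` bounds -/

/-- `max{|y|, 1}⁻¹ ≤ 2 (1 + |y|)⁻¹`. -/
theorem weightedGap_inv_max_le (y : EuclideanSpace ℝ (Fin 3)) :
    (max ‖y‖ 1)⁻¹ ≤ 2 * (1 + ‖y‖)⁻¹ := by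
  have h2 : 0 < 1 + ‖y‖ := by positivity
  have h3 : 1 + ‖y‖ ≤ 2 * max ‖y‖ 1 := by
    have := le_max_left ‖y‖ 1
    have := le_max_right ‖y‖ 1
    linarith
  calc (max ‖y‖ 1)⁻¹ = 2 * (2 * max ‖y‖ 1)⁻¹ := by
        rw [mul_inv, ← mul_assoc, mul_inv_cancel₀ (two_ne_zero), one_mul]
    _ ≤ 2 * (1 + ‖y‖)⁻¹ := mul_le_mul_of_nonneg_left (inv_anti₀ h2 h3) (by norm_num)

/-- `y ↦ max{|y|, 1}^{-4}` is integrable on `ℝ³` (comparison with `(1 + |y|)^{-4}`, `4 > 3`). -/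
theorem weightedGap_integrable_inv_max_pow_four :
    Integrable (fun y : EuclideanSpace ℝ (Fin 3) => ((max ‖y‖ 1)⁻¹) ^ 4) := by
  have hr : ((Module.finrank ℝ (EuclideanSpace ℝ (Fin 3)) : ℕ) : ℝ) < 4 := by
    rw [finrank_euclideanSpace_fin]; norm_num
  have hg : Integrable (fun y : EuclideanSpace ℝ (Fin 3) => (2 : ℝ) ^ 4 * (1 + ‖y‖) ^ (-(4 : ℝ))) :=
    (integrable_one_add_norm hr).const_mul _
  have hmeas : Continuous fun y : EuclideanSpace ℝ (Fin 3) => ((max ‖y‖ 1)⁻¹) ^ 4 :=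
    ((continuous_norm.max continuous_const).inv₀ fun y => (lt_max_of_lt_right one_pos).ne').pow 4
  refine hg.mono' hmeas.aestronglyMeasurable (Eventually.of_forall fun y => ?_)
  have h0 : 0 ≤ (max ‖y‖ 1)⁻¹ := inv_nonneg.2 (zero_le_one.trans (le_max_right _ _))
  have hpos : 0 < 1 + ‖y‖ := by positivity
  rw [Real.norm_of_nonneg (pow_nonneg h0 _), Real.rpow_neg hpos.le,
    show (4 : ℝ) = ((4 : ℕ) : ℝ) by norm_num, Real.rpow_natCast, ← inv_pow, ← mul_pow]
  exact pow_le_pow_left₀ h0 (weightedGap_inv_max_le y) 4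

/-- **Domination by `max{|y|,1}^{-n}`, `n ≥ 4`, gives integrability on `ℝ³`.** -/
theorem weightedGap_integrable_of_le_inv_max_pow {F : Type*} [NormedAddCommGroup F]
    {f : EuclideanSpace ℝ (Fin 3) → F} (hf : AEStronglyMeasurable f volume) {C : ℝ} {n : ℕ}
    (hn : 4 ≤ n) (h : ∀ y, ‖f y‖ ≤ C * ((max ‖y‖ 1)⁻¹) ^ n) : Integrable f := by
  have hC : 0 ≤ C := by
    have := (norm_nonneg _).trans (h 0)
    simpa using this
  refine (weightedGap_integrable_inv_max_pow_four.const_mul C).mono' hf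
    (Eventually.of_forall fun y => (h y).trans ?_)
  have h0 : 0 ≤ (max ‖y‖ 1)⁻¹ := inv_nonneg.2 (zero_le_one.trans (le_max_right _ _))
  have h1 : (max ‖y‖ 1)⁻¹ ≤ 1 := inv_le_one_of_one_le₀ (le_max_right _ _)
  exact mul_le_mul_of_nonneg_left (pow_le_pow_of_le_one h0 h1 hn) hC


/-! ### The slice-integrability hypotheses of the enstrophy identity for a Type-I profile -/

/-- **Slice integrability from the Type-I derivative bounds.** If `U ∈ C³(ℝ³; ℝ³)` obeys
`‖DU(y)‖ ≤ K₁ max{|y|,1}⁻²`, `‖D²U(y)‖ ≤ K₂ max{|y|,1}⁻³`, `‖D³U(y)‖ ≤ K₃ max{|y|,1}⁻⁴`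
(Pineau–Vicol (7.2) in Leray variables), then with `Ω = curl U` the four densities `|Ω|²`,
`(1 + |y|)|Ω|‖DΩ‖`, `‖DΩ‖²`, `|ΔΩ||Ω|` are integrable on `ℝ³` (each is
`O(max{|y|,1}^{-4})`). These are the slice hypotheses of `PineauVicol2026.enstrophy_slice`. -/
theorem weightedGap_slice_integrable
    {U : EuclideanSpace ℝ (Fin 3) → EuclideanSpace ℝ (Fin 3)} (hU : ContDiff ℝ 3 U)
    {K₁ K₂ K₃ : ℝ}
    (h1 : ∀ y, ‖iteratedFDeriv ℝ 1 U y‖ ≤ K₁ * ((max ‖y‖ 1)⁻¹) ^ 2)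
    (h2 : ∀ y, ‖iteratedFDeriv ℝ 2 U y‖ ≤ K₂ * ((max ‖y‖ 1)⁻¹) ^ 3)
    (h3 : ∀ y, ‖iteratedFDeriv ℝ 3 U y‖ ≤ K₃ * ((max ‖y‖ 1)⁻¹) ^ 4) :
    Integrable (fun y => ‖curl U y‖ ^ 2) ∧
    Integrable (fun y => (1 + ‖y‖) * (‖curl U y‖ * ‖fderiv ℝ (curl U) y‖)) ∧
    Integrable (fun y => ‖fderiv ℝ (curl U) y‖ ^ 2) ∧
    Integrable (fun y => ‖(Δ (curl U)) y‖ * ‖curl U y‖) := by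
  set ρ : EuclideanSpace ℝ (Fin 3) → ℝ := fun y => (max ‖y‖ 1)⁻¹ with hρ
  have hρ0 : ∀ y, 0 ≤ ρ y := fun y => inv_nonneg.2 (zero_le_one.trans (le_max_right _ _))
  have hρ1 : ∀ y, ρ y ≤ 1 := fun y => inv_le_one_of_one_le₀ (le_max_right _ _)
  have hyρ : ∀ y, (1 + ‖y‖) * ρ y ≤ 2 := fun y => by
    have hm : 0 < max ‖y‖ 1 := lt_max_of_lt_right one_pos
    rw [hρ]
    dsimp only
    rw [← div_eq_mul_inv, div_le_iff₀ hm]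
    have := le_max_left ‖y‖ 1
    have := le_max_right ‖y‖ 1
    linarith
  set κ : ℝ := ‖curlCLM‖ with hκ
  have hκ0 : 0 ≤ κ := norm_nonneg curlCLM
  have hU2 : ContDiff ℝ 2 U := hU.of_le (by norm_cast)
  have hΩ2c : ContDiff ℝ 2 (curl U) := contDiff_two_curl hU
  have hΩ1 : ContDiff ℝ 1 (curl U) := hΩ2c.of_le one_le_two
  have hΩc : Continuous (curl U) := hΩ2c.continuous
  have hDΩc : Continuous (fderiv ℝ (curl U)) := hΩ1.continuous_fderiv one_ne_zero
  have hLc : Continuous (Δ (curl U)) := continuous_laplacian hΩ2c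
  -- the three pointwise bounds
  have hΩ : ∀ y, ‖curl U y‖ ≤ κ * K₁ * ρ y ^ 2 := fun y => by
    calc ‖curl U y‖ ≤ κ * ‖fderiv ℝ U y‖ := norm_curl_le U y
      _ = κ * ‖iteratedFDeriv ℝ 1 U y‖ := by rw [norm_iteratedFDeriv_one]
      _ ≤ κ * (K₁ * ρ y ^ 2) := mul_le_mul_of_nonneg_left (h1 y) hκ0
      _ = κ * K₁ * ρ y ^ 2 := by ring
  have hDΩ : ∀ y, ‖fderiv ℝ (curl U) y‖ ≤ κ * K₂ * ρ y ^ 3 := fun y => by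
    calc ‖fderiv ℝ (curl U) y‖ ≤ κ * ‖iteratedFDeriv ℝ 2 U y‖ := norm_fderiv_curl_le hU2 y
      _ ≤ κ * (K₂ * ρ y ^ 3) := mul_le_mul_of_nonneg_left (h2 y) hκ0
      _ = κ * K₂ * ρ y ^ 3 := by ring
  have hLΩ : ∀ y, ‖(Δ (curl U)) y‖ ≤ 3 * κ * K₃ * ρ y ^ 4 := fun y => by
    calc ‖(Δ (curl U)) y‖ ≤ 3 * ‖iteratedFDeriv ℝ 2 (curl U) y‖ :=
          norm_laplacian_le_three_mul _ y
      _ ≤ 3 * (κ * ‖iteratedFDeriv ℝ 3 U y‖) :=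
          mul_le_mul_of_nonneg_left (norm_iteratedFDeriv_curl_le (n := 2) (by exact_mod_cast hU) y)
            (by norm_num)
      _ ≤ 3 * (κ * (K₃ * ρ y ^ 4)) :=
          mul_le_mul_of_nonneg_left (mul_le_mul_of_nonneg_left (h3 y) hκ0) (by norm_num)
      _ = 3 * κ * K₃ * ρ y ^ 4 := by ring
  have hK₁ : 0 ≤ κ * K₁ := by
    have := (norm_nonneg _).trans (hΩ 0)
    have e : ρ 0 = 1 := by simp [hρ]
    rw [e, one_pow, mul_one] at this
    exact this
  refine ⟨?_, ?_, ?_, ?_⟩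
  · refine weightedGap_integrable_of_le_inv_max_pow (hΩc.norm.pow 2).aestronglyMeasurable
      (C := (κ * K₁) ^ 2) (n := 4) le_rfl fun y => ?_
    rw [Real.norm_of_nonneg (sq_nonneg _), show ((max ‖y‖ 1)⁻¹) ^ 4 = (ρ y ^ 2) ^ 2 by
      rw [hρ]; ring, ← mul_pow]
    exact pow_le_pow_left₀ (norm_nonneg _) (hΩ y) 2
  · refine weightedGap_integrable_of_le_inv_max_pow
      (((continuous_const.add continuous_norm)).mul (hΩc.norm.mul hDΩc.norm)).aestronglyMeasurable
      (C := 2 * (κ * K₁) * (κ * K₂)) (n := 4) le_rfl fun y => ?_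
    rw [Real.norm_of_nonneg (by positivity)]
    have hprod : ‖curl U y‖ * ‖fderiv ℝ (curl U) y‖ ≤ (κ * K₁ * ρ y ^ 2) * (κ * K₂ * ρ y ^ 3) :=
      mul_le_mul (hΩ y) (hDΩ y) (norm_nonneg _) ((norm_nonneg _).trans (hΩ y))
    have hK₂ : 0 ≤ κ * K₂ * ρ y ^ 3 := (norm_nonneg _).trans (hDΩ y)
    calc (1 + ‖y‖) * (‖curl U y‖ * ‖fderiv ℝ (curl U) y‖)
        ≤ (1 + ‖y‖) * ((κ * K₁ * ρ y ^ 2) * (κ * K₂ * ρ y ^ 3)) :=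
          mul_le_mul_of_nonneg_left hprod (by positivity)
      _ = ((1 + ‖y‖) * ρ y) * ((κ * K₁) * (κ * K₂ * ρ y ^ 3) * ρ y) := by ring
      _ ≤ 2 * ((κ * K₁) * (κ * K₂ * ρ y ^ 3) * ρ y) :=
          mul_le_mul_of_nonneg_right (hyρ y)
            (mul_nonneg (mul_nonneg hK₁ hK₂) (hρ0 y))
      _ = 2 * (κ * K₁) * (κ * K₂) * ((max ‖y‖ 1)⁻¹) ^ 4 := by rw [hρ]; ring
  · refine weightedGap_integrable_of_le_inv_max_pow (hDΩc.norm.pow 2).aestronglyMeasurable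
      (C := (κ * K₂) ^ 2) (n := 6) (by norm_num) fun y => ?_
    rw [Real.norm_of_nonneg (sq_nonneg _), show ((max ‖y‖ 1)⁻¹) ^ 6 = (ρ y ^ 3) ^ 2 by
      rw [hρ]; ring, ← mul_pow]
    exact pow_le_pow_left₀ (norm_nonneg _) (hDΩ y) 2
  · refine weightedGap_integrable_of_le_inv_max_pow (hLc.norm.mul hΩc.norm).aestronglyMeasurable
      (C := (3 * κ * K₃) * (κ * K₁)) (n := 6) (by norm_num) fun y => ?_
    rw [Real.norm_of_nonneg (by positivity)]
    calc ‖(Δ (curl U)) y‖ * ‖curl U y‖ ≤ (3 * κ * K₃ * ρ y ^ 4) * (κ * K₁ * ρ y ^ 2) :=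
          mul_le_mul (hLΩ y) (hΩ y) (norm_nonneg _) ((norm_nonneg _).trans (hLΩ y))
      _ = (3 * κ * K₃) * (κ * K₁) * ((max ‖y‖ 1)⁻¹) ^ 6 := by rw [hρ]; ring

/-! ### The rotation wind: `∫ ⟪(Jy·∇)Ω, Ω⟫ = 0` -/

/-- **The angular transport term vanishes**: for a `C¹` field `Ω` on `ℝ³` with `|Ω|²` and
`|y| |Ω| ‖DΩ‖` integrable, `∫ ⟪DΩ(y)[Jy], Ω(y)⟫ dy = 0`, `J = rotGen` the infinitesimal rotation
about the `e₃`-axis (`⟪DΩ[Jy], Ω⟫ = div(½|Ω|² Jy)` as `div (Jy) = 0`; the flux `½|Ω|² Jy` obeys the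
logarithmic flux condition `|F|/(1+|y|) ≤ ½|Ω|² ∈ L¹` of
`PineauVicol2026.integral_divergence_eq_zero_of_integrable_div`). -/
theorem weightedGap_integral_inner_fderiv_rotGen_self {F' : Type*} [NormedAddCommGroup F']
    [InnerProductSpace ℝ F'] {Ω : EuclideanSpace ℝ (Fin 3) → F'} (hΩ : ContDiff ℝ 1 Ω)
    (h2 : Integrable fun y => ‖Ω y‖ ^ 2)
    (hD : Integrable fun y => ‖y‖ * (‖Ω y‖ * ‖fderiv ℝ Ω y‖)) :
    ∫ y, ⟪fderiv ℝ Ω y (rotGen y), Ω y⟫ = 0 := by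
  have hθ : ContDiff ℝ 1 (fun y => (1 / 2 : ℝ) * ‖Ω y‖ ^ 2) := contDiff_const.mul (hΩ.norm_sq ℝ)
  have hΩd : ∀ y, DifferentiableAt ℝ Ω y := fun y => hΩ.differentiable one_ne_zero y
  have hθd : ∀ y, DifferentiableAt ℝ (fun y => (1 / 2 : ℝ) * ‖Ω y‖ ^ 2) y := fun y =>
    hθ.differentiable one_ne_zero y
  have hJd : ∀ y : EuclideanSpace ℝ (Fin 3), DifferentiableAt ℝ rotGen y := fun y =>
    (hasFDerivAt_rotGen y).differentiableAt
  have hJ1 : ContDiff ℝ 1 (rotGen : EuclideanSpace ℝ (Fin 3) → EuclideanSpace ℝ (Fin 3)) := by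
    have e : (rotGen : EuclideanSpace ℝ (Fin 3) → EuclideanSpace ℝ (Fin 3)) = fun v => rotGenL v :=
      funext fun v => (rotGenL_apply v).symm
    rw [e]
    exact rotGenL.contDiff
  -- `div J = 0` (`tr J = Σᵢ ⟪eᵢ, J eᵢ⟫ = 0`)
  have hdivJ : ∀ y : EuclideanSpace ℝ (Fin 3), VectorCalculus.divergence rotGen y = 0 := fun y => by
    rw [divergence_eq_sum_inner_fderiv (EuclideanSpace.basisFun (Fin 3) ℝ),
      (hasFDerivAt_rotGen y).fderiv]
    refine Finset.sum_eq_zero fun i _ => ?_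
    rw [rotGenL_apply, real_inner_comm, inner_rotGen_self]
  have hdivF : ∀ y, VectorCalculus.divergence (fun z => ((1 / 2 : ℝ) * ‖Ω z‖ ^ 2) • rotGen z) y =
      ⟪fderiv ℝ Ω y (rotGen y), Ω y⟫ := by
    intro y
    rw [divergence_smul_apply (hθd y) (hJd y), hdivJ, mul_zero, zero_add,
      gradient, real_inner_comm, InnerProductSpace.toDual_symm_apply, fderiv_half_norm_sq_apply (hΩd y)]
  have hF1 : ContDiff ℝ 1 (fun z => ((1 / 2 : ℝ) * ‖Ω z‖ ^ 2) • rotGen z) := hθ.smul hJ1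
  have hFi : Integrable fun y => ‖((1 / 2 : ℝ) * ‖Ω y‖ ^ 2) • rotGen y‖ / (1 + ‖y‖) := by
    refine (h2.const_mul (1 / 2)).mono' ?_ (Eventually.of_forall fun y => ?_)
    · exact ((hF1.continuous.norm).div (continuous_const.add continuous_norm)
        fun y => (by positivity : (0 : ℝ) < 1 + ‖y‖).ne').aestronglyMeasurable
    · rw [Real.norm_eq_abs, abs_of_nonneg (by positivity), norm_smul, Real.norm_eq_abs,
        abs_of_nonneg (by positivity)]
      have h1 : 0 < 1 + ‖y‖ := by positivity
      rw [div_le_iff₀ h1]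
      have hJ := norm_rotGen_le y
      nlinarith [norm_nonneg y, sq_nonneg ‖Ω y‖, norm_nonneg (rotGen y)]
  have hinner : Integrable fun y => ⟪fderiv ℝ Ω y (rotGen y), Ω y⟫ := by
    refine hD.mono' ?_ (Eventually.of_forall fun y => ?_)
    · exact (((hΩ.continuous_fderiv one_ne_zero).clm_apply hJ1.continuous).inner
        hΩ.continuous).aestronglyMeasurable
    · rw [Real.norm_eq_abs]
      calc |⟪fderiv ℝ Ω y (rotGen y), Ω y⟫| ≤ ‖fderiv ℝ Ω y (rotGen y)‖ * ‖Ω y‖ :=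
            abs_real_inner_le_norm _ _
        _ ≤ ‖fderiv ℝ Ω y‖ * ‖rotGen y‖ * ‖Ω y‖ :=
            mul_le_mul_of_nonneg_right ((fderiv ℝ Ω y).le_opNorm _) (norm_nonneg _)
        _ ≤ ‖fderiv ℝ Ω y‖ * ‖y‖ * ‖Ω y‖ :=
            mul_le_mul_of_nonneg_right
              (mul_le_mul_of_nonneg_left (norm_rotGen_le y) (norm_nonneg _)) (norm_nonneg _)
        _ = ‖y‖ * (‖Ω y‖ * ‖fderiv ℝ Ω y‖) := by ring
  have hdi : Integrable fun y =>
      VectorCalculus.divergence (fun z => ((1 / 2 : ℝ) * ‖Ω z‖ ^ 2) • rotGen z) y := by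
    simp_rw [hdivF]
    exact hinner
  have h := integral_divergence_eq_zero_of_integrable_div hF1 hFi hdi
  simp_rw [hdivF] at h
  exact h

/-! ### The time term of the enstrophy identity for a rigidly rotating profile -/

/-- **The time derivative of the vorticity of a rotating profile, paired with the vorticity.**
Let `(V, Q)` solve the backward Leray system on `ℝ × ℝ³` and let `V` be a rigidly rotating
profile, `V(s, y) = R(αs) U(R(−αs) y)`. Then at `s = 0` (where `V(0) = U`),
`⟪∂ₛΩ(0, y), Ω(0, y)⟫ = −α ⟪DΩ_U(y)[Jy], Ω_U(y)⟫`, `Ω_U = curl U`, `J = rotGen`: indeed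
`Ω(s, y) = R(αs) Ω_U(R(−αs) y)` (`PineauVicol2026.curl_rotZ_conj`), so
`½|Ω(s, y)|² = ½|Ω_U|²(R(−αs) y)`, whose `s`-derivative at `0` is `D(½|Ω_U|²)(y)[−αJy]`
(`hasDerivAt_rotZ_zero`). -/
theorem weightedGap_inner_timeDeriv_vorticity_eq
    {V : ℝ → EuclideanSpace ℝ (Fin 3) → EuclideanSpace ℝ (Fin 3)}
    {Q : ℝ → EuclideanSpace ℝ (Fin 3) → ℝ} (hL : IsBackwardLeraySolutionOn univ 1 V Q)
    {α : ℝ} {U : EuclideanSpace ℝ (Fin 3) → EuclideanSpace ℝ (Fin 3)}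
    (hVeq : ∀ s y, V s y = rotZ (α * s) (U (rotZ (-(α * s)) y))) (y : EuclideanSpace ℝ (Fin 3)) :
    ⟪timeDerivWithin univ (vorticity V) 0 y, curl (V 0) y⟫ =
      -α * ⟪fderiv ℝ (curl U) y (rotGen y), curl U y⟫ := by
  have hV0 : V 0 = U := funext fun z => by rw [hVeq, mul_zero, neg_zero, rotZ_zero, rotZ_zero]
  have hUs : ContDiff ℝ ∞ U := by
    rw [← hV0]; exact hL.smooth_velocity.contDiff_slice (mem_univ 0)
  have hUd : Differentiable ℝ U := hUs.differentiable (by simp)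
  have hΩ1 : ContDiff ℝ 1 (curl U) :=
    (contDiff_two_curl (hUs.of_le (by norm_cast))).of_le one_le_two
  have hΩd : Differentiable ℝ (curl U) := hΩ1.differentiable one_ne_zero
  have hΩsm : IsSmoothSpaceTimeOn univ (vorticity V) :=
    hL.smooth_velocity.isSmoothSpaceTimeOn_vorticity uniqueDiffOn_univ
  -- the derivative of the vorticity line, paired with the vorticity
  have h1 : HasDerivAt (fun s => vorticity V s y) (timeDerivWithin univ (vorticity V) 0 y) 0 :=
    hasDerivWithinAt_univ.1 (hΩsm.hasDerivWithinAt_timeDerivWithin uniqueDiffOn_univ (mem_univ 0) y)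
  have h2 : HasDerivAt (fun s => (1 / 2 : ℝ) * ‖vorticity V s y‖ ^ 2)
      ⟪timeDerivWithin univ (vorticity V) 0 y, curl (V 0) y⟫ 0 := by
    refine ((h1.norm_sq).const_mul (1 / 2 : ℝ)).congr_deriv ?_
    rw [vorticity_apply, real_inner_comm]
    ring
  -- the same function through the rotation orbit
  set g : EuclideanSpace ℝ (Fin 3) → ℝ := fun z => (1 / 2 : ℝ) * ‖curl U z‖ ^ 2 with hg
  have hrot : (fun s => (1 / 2 : ℝ) * ‖vorticity V s y‖ ^ 2) = fun s => g (rotZ (-(α * s)) y) := by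
    funext s
    have hVs : V s = fun z => rotZ (α * s) (U (rotZ (-(α * s)) z)) := funext (hVeq s)
    simp only [hg, vorticity_apply]
    rw [hVs, curl_rotZ_conj hUd, norm_rotZ]
  have hh : HasDerivAt (fun s : ℝ => -(α * s)) (-α) 0 := by
    simpa using (hasDerivAt_id (0 : ℝ)).const_mul (-α)
  have hr : HasDerivAt (fun θ => rotZ θ y) (rotGen y) (-(α * 0)) := by
    rw [mul_zero, neg_zero]; exact hasDerivAt_rotZ_zero y
  -- `s ↦ R(−αs) y` has velocity `−α J y` at `s = 0`
  have hγ := hr.scomp (0 : ℝ) hh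
  have hgd : Differentiable ℝ g := (contDiff_const.mul (hΩ1.norm_sq ℝ)).differentiable one_ne_zero
  have hgy : HasFDerivAt g (fderiv ℝ g y) (rotZ (-(α * 0)) y) := by
    rw [mul_zero, neg_zero, rotZ_zero]; exact (hgd y).hasFDerivAt
  have h3 := hgy.comp_hasDerivAt (0 : ℝ) hγ
  rw [hrot] at h2
  have key : ⟪timeDerivWithin univ (vorticity V) 0 y, curl (V 0) y⟫ = fderiv ℝ g y ((-α) • rotGen y) :=
    h2.unique h3
  rw [key, map_smul, smul_eq_mul, hg, fderiv_half_norm_sq_apply (hΩd y)]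

/-- **The time term of the enstrophy identity vanishes for a rigidly rotating profile.** Under
the hypotheses of `weightedGap_inner_timeDeriv_vorticity_eq`, if `|curl U|²` and
`(1 + |y|)|curl U|‖D curl U‖` are integrable then
`∫ ⟪∂ₛΩ(0, y), Ω(0, y)⟫ dy = −α ∫ ⟪DΩ_U[Jy], Ω_U⟫ = 0`
(`weightedGap_integral_inner_fderiv_rotGen_self`). This is the input `htime` of the period
argument of Pineau–Vicol §7.5 in the RSS case, at a single slice. -/
theorem weightedGap_timeTerm_eq_zero
    {V : ℝ → EuclideanSpace ℝ (Fin 3) → EuclideanSpace ℝ (Fin 3)}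
    {Q : ℝ → EuclideanSpace ℝ (Fin 3) → ℝ} (hL : IsBackwardLeraySolutionOn univ 1 V Q)
    {α : ℝ} {U : EuclideanSpace ℝ (Fin 3) → EuclideanSpace ℝ (Fin 3)}
    (hVeq : ∀ s y, V s y = rotZ (α * s) (U (rotZ (-(α * s)) y)))
    (hΩ2 : Integrable fun y => ‖curl U y‖ ^ 2)
    (hΩD : Integrable fun y => (1 + ‖y‖) * (‖curl U y‖ * ‖fderiv ℝ (curl U) y‖)) :
    ∫ y, ⟪timeDerivWithin univ (vorticity V) 0 y, curl (V 0) y⟫ = 0 := by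
  have hV0 : V 0 = U := funext fun z => by rw [hVeq, mul_zero, neg_zero, rotZ_zero, rotZ_zero]
  have hUs : ContDiff ℝ ∞ U := by
    rw [← hV0]; exact hL.smooth_velocity.contDiff_slice (mem_univ 0)
  have hΩ2c : ContDiff ℝ 2 (curl U) := contDiff_two_curl (hUs.of_le (by norm_cast))
  have hΩ1 : ContDiff ℝ 1 (curl U) := hΩ2c.of_le one_le_two
  have hΩc : Continuous (curl U) := hΩ2c.continuous
  have hDΩc : Continuous (fderiv ℝ (curl U)) := hΩ1.continuous_fderiv one_ne_zero
  have hyΩD : Integrable fun y => ‖y‖ * (‖curl U y‖ * ‖fderiv ℝ (curl U) y‖) :=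
    hΩD.mono' ((continuous_norm).mul (hΩc.norm.mul hDΩc.norm)).aestronglyMeasurable
      (Eventually.of_forall fun y => by
        rw [Real.norm_eq_abs, abs_of_nonneg (by positivity)]
        nlinarith [mul_nonneg (norm_nonneg (curl U y)) (norm_nonneg (fderiv ℝ (curl U) y)),
          norm_nonneg y])
  simp_rw [weightedGap_inner_timeDeriv_vorticity_eq hL hVeq]
  rw [integral_const_mul, weightedGap_integral_inner_fderiv_rotGen_self hΩ1 hΩ2 hyΩD, mul_zero]

/-- **Registered helper stub `weightedGap_rssTimeTermVanishes` (explicit-binder form of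
`weightedGap_timeTerm_eq_zero`).** For a classical solution `(V, Q)` of the backward Leray
system on `ℝ × ℝ³` which is a rigidly rotating profile `V(s, y) = R(αs) U(R(−αs) y)`, with
`|curl U|²` and `(1 + |y|)|curl U|‖D curl U‖` integrable, the time term of the enstrophy
identity at the slice `s = 0` vanishes: `∫ ⟪∂ₛΩ(0, y), Ω(0, y)⟫ dy = 0`. -/
theorem weightedGap_rssTimeTermVanishes :
    ∀ (V : ℝ → EuclideanSpace ℝ (Fin 3) → EuclideanSpace ℝ (Fin 3)) (Q : ℝ → EuclideanSpace ℝ (Fin 3) → ℝ) (α : ℝ) (U : EuclideanSpace ℝ (Fin 3) → EuclideanSpace ℝ (Fin 3)), Literature.Analysis.FluidPDE.IsBackwardLeraySolutionOn Set.univ 1 V Q → (∀ (s : ℝ) (y : EuclideanSpace ℝ (Fin 3)), V s y = Literature.Analysis.FluidPDE.rotZ (α * s) (U (Literature.Analysis.FluidPDE.rotZ (-(α * s)) y))) → MeasureTheory.Integrable (fun y : EuclideanSpace ℝ (Fin 3) => ‖Literature.Analysis.FluidPDE.curl U y‖ ^ 2) → MeasureTheory.Integrable (fun y : EuclideanSpace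 ℝ (Fin 3) => (1 + ‖y‖) * (‖Literature.Analysis.FluidPDE.curl U y‖ * ‖fderiv ℝ (Literature.Analysis.FluidPDE.curl U) y‖)) → ∫ y : EuclideanSpace ℝ (Fin 3), inner ℝ (Literature.Analysis.FluidPDE.timeDerivWithin Set.univ (Literature.Analysis.FluidPDE.vorticity V) 0 y) (Literature.Analysis.FluidPDE.curl (V 0) y) = 0 :=
  fun _ _ _ _ hL hVeq hΩ2 hΩD => weightedGap_timeTerm_eq_zero hL hVeq hΩ2 hΩD

end Summit.NavierStokesRegularity.NavierStokesRegularity.Theorems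

end
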